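import Summits.HodgeConjecture.HodgeConjecture.Theorems.VHCAbelianSchemesRoadDiagonal
import HarnessLib

/-!
# Road b02 (`VHCAbelianSchemesRoad`, D-0059) — THE DIAGONAL HAS NO LOAD-BEARING CELL: every TAIL `{(2m, m) : m ≥ M₀}` of the
# crux's diagonal already gives ring 2's node (U), row b02 and `HC_AV` — fact-free, no class target, no `HC_CM`

research route conditional on HC_CM; not a corollary; Q11.4-sentence-2 already refuted in dim ≥ 3.
(cell line of seat ab-andre-2: research route, not a corollary; conditional on HC_CM plus one named minimal statement.)

THEOREMS ONLY (no definition, no named fact, no sorry; `HC_CM` occurs nowhere; nothing of the road's research content — a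
semiregular (twisted) carrier on some fibre — is claimed). Seat ab-andre-2 gen 56, PART Y.

WHAT THIS FILE PROVES. Part X-a (`VHCAbelianSchemesRoadDiagonal.lean`, p448719) moved every class `W` of codimension `p` on a
one-parameter abelian scheme of relative dimension `n` to the MIDDLE degree of a padded pencil — the diagonal cell `(2m, m)`,
`m = max(p, n − p)` — and concluded node (U) from the door and the diagonal cells `m ≥ 2` (FACT-FREE) or `m ≥ 3` (modulo
`HCUpToDim 5`, Markman 2025, UNREFEREED); part X-b/X-d needed `HC_CM` to start at `m ≥ 4` / `m ≥ 6`. The class target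
`HCUpToDim G` entered ONLY to serve the pencils of relative dimension `n ≤ G`, which the engine could not pad UPWARDS. Here is
the missing move, again by pull-backs only:

* §1 **PURE PADDING** `exists_purePadding`: `𝒳 ↦ 𝒳 × B` (`B` any complex abelian variety), `W ↦ W♮ := pr_𝒳^* W` — SAME
  codimension `p`, relative dimension `n + dim B`; `W♮` is fibrewise rational of type `(p, p)` and `W♮|_{(𝒳 × B)_s}` is algebraic
  ⟺ `W|_{𝒳_s}` is algebraic, for EVERY `s` (`⟸`: the flat `pr^*`, `map_fst_mem_supportedClasses`; `⟹`: restriction to the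
  slice `𝒳_s × {t} ≅ 𝒳_s`, ring2-b02's `mem_algebraicClasses_of_map_fst_mem` — specialisation of cycles, Fulton §10.1). The
  padded pencil is again a one-parameter abelian scheme over the SAME affine curve, with a section and quasi-projective total
  space (part X-a §1).
* §2 **THE TAIL ENGINE** `not_countable_algebraicityLocus_of_diagonal_tail`: part X-a's per-pencil conclusion of node (U) from
  the diagonal cells `(2m, m)` with `2m > G` — WITHOUT its hypothesis `G < n`: pad by `B` of dimension `G + 1` first. Hence
  §3: node (U), row b02 and `HC_AV` from the door and ANY TAIL `∀ m ≥ M₀` of diagonal cells of the graded crux — for EVERY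
  `M₀`, FACT-FREE (no `HCUpToDim`, no `HC_CM`, no Markman); §4 the same in the `closes`-shape of the road over the TWISTED door.

CONSEQUENCES FOR THE ROAD (recorded, not route edits): (i) in the option-(α) crux `SemiregularSheafRepresentativesTwAtDiag`
(«regime 2 at every diagonal cell `m ≥ 2`», LEAD gen 149 pre-read) NO SINGLE CELL IS LOAD-BEARING for `HC_AV`: the cells
`(4, 2)` (first cell) and `(6, 3)` (the BC5 rung) can be struck from the hypothesis and `closes` still elaborates
(`hc_av_of_exceptionalRegimeAt_twisted_diagonal_ge` at `M₀ = 4`, i.e. from the candidate skeleton's TAIL stub alone); (ii) the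
repair option (β) «slice `m ≥ 3`» needs NO residual `HodgeAbelianDimLeFive`; (iii) the slices «`m ≥ 4`» / «`m ≥ 6`» of parts
X-b/X-d need NO `HC_CM`: on this road `HC_CM` is IDLE for `HC_AV` (it still buys «one cell per dimension», sequel); (iv) the
weakest statement of this shape the road can consume is «regime 2 at INFINITELY MANY diagonal cells» (sequel, single-cell
engine). NOT claimed: any cell of the crux; the converse «`HC_AV` ⟹ some tail»; crux-level implications between cells (there
are none here: a datum on `𝒳_s × B` is not a datum on `𝒳_s`).

References: [BrosnanFangNiePearlstein2009] §6 Lemma 48; [Fulton1998] §10.1 Cor. 10.1, Example 10.1.2; [CharlesSchnell2014Notes]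
Conj. 11.3.1, Prop. 11.3.11; [Lieberman1968]; [VoisinHodgeI2002] §7.3.2, Thm. 11.30; [Andre1996Motifs] §6.3; [GortzWedhorn2023]
Thm. 27.291; [Hartshorne1977] II.3 p. 89, II Ex. 4.9, III Prop. 10.1; [MumfordAV1970] §1.
-/

noncomputable section

open CategoryTheory CategoryTheory.Limits AlgebraicGeometry Topology MonoidalCategory CartesianMonoidalCategory

namespace Summit.HodgeConjecture.HodgeConjecture.Ring2.SemiregularRepresentatives

set_option linter.dupNamespace false -- the cell's namespace repeats the summit name, as in every `Ring2*` file

open Literature.AlgebraicGeometry Literature.AlgebraicGeometry.Motives Literature.AlgebraicGeometry.HodgeTheory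
open Literature.AlgebraicTopology.SingularHomology
open Literature.AlgebraicGeometry.Andre1996 (andre1996_cmAnchoredPencil
  andre1996_cmHodgeClasses_algebraicallyAnchoredPencils)
open Summit.Ventures.HSemireg (ObjClass LocalVariationalHodgeFor)
open Summit.HodgeConjecture.HodgeConjecture.Ring2.Hypotheses (AbelianSchemeVHC)
open Summit.HodgeConjecture.HodgeConjecture.Ring2.Binders
open Summit.HodgeConjecture.HodgeConjecture.Ring2.ClassTargets

variable {𝒳 S : SchemeOver ℂ}

/-! ## §1 Pure padding: `𝒳 × B ⟶ S`, `W♮ = pr_𝒳^* W` — same codimension, same algebraicity locus -/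

/-- **PURE PADDING.** Let `f : 𝒳 ⟶ S` be a smooth projective family of relative dimension `n` with quasi-projective total space,
all complex fibres abelian varieties, `B` a complex abelian variety and `W ∈ H²ᵖ(𝒳(ℂ); ℂ)` fibrewise rational of type `(p, p)`.
Then `pr_𝒳 ≫ f : 𝒳 × B ⟶ S` is a smooth projective family of relative dimension `n + dim B` with abelian fibres
(ring2-b02's `isSmoothProjectiveFamily_fst_comp`, `exists_abelianVariety_iso_fiberOver_fst_comp`), and `W♮ := pr_𝒳^* W` —
SAME degree `2p` — is fibrewise rational of type `(p, p)` with `W♮|_{(𝒳 × B)_s}` algebraic iff `W|_{𝒳_s}` algebraic, for EVERY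
`s`. On the fibre, `W♮| = e^* pr^*(W|)` (`e : (𝒳 × B)_s ≅ 𝒳_s × B`, `exists_fiberOver_fst_comp_iso`): rational (`.map`), of type
`(p, p)` (pull-backs between smooth projective varieties preserve Hodge types, `IsOfHodgeType.map_of_isSmoothProjective`);
`⟸`: the flat `pr^*` moves algebraic classes (`map_fst_mem_supportedClasses`); `⟹`: restriction to a slice `𝒳_s × {t}`
(`mem_algebraicClasses_of_map_fst_mem`). FACT-FREE. [cite: Fulton1998, §10.1 Cor. 10.1 and Example 10.1.2]
[cite: VoisinHodgeI2002, §7.3.2] [cite: Hartshorne1977, II.3 (p. 89) and III Prop. 10.1 (b)] -/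
theorem exists_purePadding (f : 𝒳 ⟶ S) {n : ℕ} (hf : IsSmoothProjectiveFamily f n)
    (hA : ∀ s : ComplexPoints S, ∃ A' : AbelianVariety ℂ, A'.dim = n ∧ Nonempty (A'.X ≅ fiberOver f s))
    (B : AbelianVariety ℂ) (p : ℕ) (W : complexBetti 𝒳 (2 * p))
    (hW : ∀ s : ComplexPoints S, IsRationalClass (complexBetti.map (fiberι f s) (2 * p) W) ∧
      IsOfHodgeType n (fiberOver f s) (2 * p) p p (complexBetti.map (fiberι f s) (2 * p) W)) :
    IsSmoothProjectiveFamily (fst 𝒳 B.X ≫ f) (n + B.dim) ∧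
    (∀ s : ComplexPoints S, ∃ A'' : AbelianVariety ℂ, A''.dim = n + B.dim ∧
      Nonempty (A''.X ≅ fiberOver (fst 𝒳 B.X ≫ f) s)) ∧
    ∃ W' : complexBetti (𝒳 ⊗ B.X) (2 * p),
      (∀ s : ComplexPoints S, IsRationalClass (complexBetti.map (fiberι (fst 𝒳 B.X ≫ f) s) (2 * p) W') ∧
        IsOfHodgeType (n + B.dim) (fiberOver (fst 𝒳 B.X ≫ f) s) (2 * p) p p
          (complexBetti.map (fiberι (fst 𝒳 B.X ≫ f) s) (2 * p) W')) ∧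
      ∀ s : ComplexPoints S,
        complexBetti.map (fiberι (fst 𝒳 B.X ≫ f) s) (2 * p) W' ∈ algebraicClasses (fiberOver (fst 𝒳 B.X ≫ f) s) p ↔
          complexBetti.map (fiberι f s) (2 * p) W ∈ algebraicClasses (fiberOver f s) p := by
  have hB : IsSmoothProjective B.dim B.X := AbelianVariety.isSmoothProjective_holds
  refine ⟨isSmoothProjectiveFamily_fst_comp f hf hB, exists_abelianVariety_iso_fiberOver_fst_comp f hA B, ?_⟩
  -- the restriction of `W♮ = pr^* W` to the fibre over `s`, read on `𝒳_s × B` through `e : 𝒳_s × B ≅ (𝒳 × B)_s`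
  have key : ∀ s : ComplexPoints S, ∃ e : fiberOver f s ⊗ B.X ≅ fiberOver (fst 𝒳 B.X ≫ f) s,
      complexBetti.map (fiberι (fst 𝒳 B.X ≫ f) s) (2 * p) (complexBetti.map (fst 𝒳 B.X) (2 * p) W) =
        complexBetti.map e.inv (2 * p) (complexBetti.map (fst (fiberOver f s) B.X) (2 * p)
          (complexBetti.map (fiberι f s) (2 * p) W)) := fun s ↦ by
    obtain ⟨e, he⟩ := exists_fiberOver_fst_comp_iso f B.X s
    refine ⟨e, ?_⟩
    have hι' : fiberι (fst 𝒳 B.X ≫ f) s = e.inv ≫ fiberι f s ▷ B.X := e.eq_inv_comp.2 he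
    have hι : fiberι (fst 𝒳 B.X ≫ f) s ≫ fst 𝒳 B.X = e.inv ≫ fst (fiberOver f s) B.X ≫ fiberι f s := by
      rw [hι', Category.assoc, whiskerRight_fst]
    calc complexBetti.map (fiberι (fst 𝒳 B.X ≫ f) s) (2 * p) (complexBetti.map (fst 𝒳 B.X) (2 * p) W)
        = complexBetti.map (fiberι (fst 𝒳 B.X ≫ f) s ≫ fst 𝒳 B.X) (2 * p) W := (complexBetti.map_comp_apply' _ _ _ _).symm
      _ = complexBetti.map (e.inv ≫ fst (fiberOver f s) B.X ≫ fiberι f s) (2 * p) W := by rw [hι]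
      _ = _ := by rw [complexBetti.map_comp_apply', complexBetti.map_comp_apply']
  refine ⟨complexBetti.map (fst 𝒳 B.X) (2 * p) W, fun s ↦ ?_, fun s ↦ ?_⟩
  · -- fibrewise rational of type `(p, p)`
    obtain ⟨e, he⟩ := key s
    rw [he]
    exact ⟨(((hW s).1).map _).map _,
      (isOfHodgeType_map_iff_of_iso e.symm).2 ((hW s).2.map_of_isSmoothProjective
        (IsSmoothProjective.tensor_holds (hf.isSmoothProjective s) hB) (hf.isSmoothProjective s)
        (fst (fiberOver f s) B.X))⟩
  · -- the two algebraicity loci coincide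
    obtain ⟨e, he⟩ := key s
    rw [he]
    refine ⟨fun h ↦ ?_, fun h ↦ ?_⟩
    · -- `⟹`: undo the iso, descend the slice
      exact mem_algebraicClasses_of_map_fst_mem (hf.isSmoothProjective s) B
        ((mem_algebraicClasses_map_iff_of_iso e.symm).1 h)
    · -- `⟸`: the flat pull-back `pr^*`, then the iso
      exact map_mem_algebraicClasses_of_isIso e.inv
        (map_fst_mem_supportedClasses (hf.isSmoothProjective s) hB h)

/-! ## §2 The tail engine: part X-a's diagonal engine WITHOUT the hypothesis `G < n` (pad upwards first) -/

/-- **The conclusion of node (U) at `(n, p)` from the diagonal cells `(2m, m)`, `2m > G`, per pencil — for EVERY relative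
dimension `n`** (part X-a's `not_countable_algebraicityLocus_of_diagonal` needed `G < n`): pad the pencil by an abelian variety
`B` of dimension `G + 1` (§1: same codimension, same algebraicity locus, relative dimension `n + G + 1 > G`), then part X-a's
engine (lower shadow, middle lift, the graded crux at a diagonal cell `2m ≥ n + G + 1 > G`, the door).
[cite: BrosnanFangNiePearlstein2009, §6 Lemma 48] [cite: Lieberman1968, main theorem] [cite: Fulton1998, §10.1 Cor. 10.1]
[cite: BuchweitzFlenner2003, §5 Thm. 5.1] -/
theorem not_countable_algebraicityLocus_of_diagonal_tail {𝒪 : ObjClass} (hT : LocalVariationalHodgeFor 𝒪)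
    {G : ℕ} (hSR : ∀ m : ℕ, G < 2 * m → AdmissibleRepresentativesLefAtDeg 𝒪 (2 * m) m)
    (f : 𝒳 ⟶ S) {n : ℕ} (hf : IsSmoothProjectiveFamily f n) (h𝒳 : IsQuasiProjectiveOver 𝒳)
    [IrreducibleSpace S.left] [IsAffine S.left] [AlgebraicGeometry.Smooth S.hom] (hdim : topologicalKrullDim S.left = 1)
    (habel : ∀ s : ComplexPoints S, ∃ A' : AbelianVariety ℂ, A'.dim = n ∧ Nonempty (A'.X ≅ fiberOver f s))
    (he : ∃ e : S ⟶ 𝒳, e ≫ f = 𝟙 S) (p : ℕ) (W : complexBetti 𝒳 (2 * p))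
    (hW : ∀ s : ComplexPoints S, IsRationalClass (complexBetti.map (fiberι f s) (2 * p) W) ∧
      IsOfHodgeType n (fiberOver f s) (2 * p) p p (complexBetti.map (fiberι f s) (2 * p) W))
    {s₀ : ComplexPoints S} (hs₀ : complexBetti.map (fiberι f s₀) (2 * p) W ∈ algebraicClasses (fiberOver f s₀) p) :
    ¬ {s : ComplexPoints S |
        complexBetti.map (fiberι f s) (2 * p) W ∈ algebraicClasses (fiberOver f s) p}.Countable := by
  obtain ⟨B, hB⟩ := exists_abelianVariety_dim_eq_succ ℂ G
  obtain ⟨hf', habel', W', hW', hiff⟩ := exists_purePadding f hf habel B p W hW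
  have h := not_countable_algebraicityLocus_of_diagonal hT hSR (fst 𝒳 B.X ≫ f) hf' (by omega)
    (isQuasiProjectiveOver_tensor h𝒳 (AbelianVariety.isSmoothProjective_holds (A := B)).isProjectiveOver) hdim habel'
    (exists_section_fst_comp f he B) p W' hW' ((hiff s₀).2 hs₀)
  have hset : {s : ComplexPoints S | complexBetti.map (fiberι (fst 𝒳 B.X ≫ f) s) (2 * p) W' ∈
        algebraicClasses (fiberOver (fst 𝒳 B.X ≫ f) s) p} =
      {s : ComplexPoints S | complexBetti.map (fiberι f s) (2 * p) W ∈ algebraicClasses (fiberOver f s) p} :=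
    Set.ext fun s => hiff s
  rwa [hset] at h

/-! ## §3 The nodes from ANY TAIL of the diagonal — no class target, no `HC_CM` -/

/-- **Node (U) from the door and the diagonal cells `(2m, m)` with `2m > G` of the graded crux — for EVERY `G`, FACT-FREE**
(no `HCUpToDim G`: part X-a's `oneParameterAbelianSchemeVHCUncountable_of_hcUpToDim_of_lefAtDeg_diagonal` with the class target
struck). [cite: CharlesSchnell2014Notes, Conj. 11.3.1 and Prop. 11.3.11 (proof)] [cite: BrosnanFangNiePearlstein2009, §6 Lemma 48]
[cite: Fulton1998, §10.1 Cor. 10.1] -/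
theorem oneParameterAbelianSchemeVHCUncountable_of_lefAtDeg_diagonal_tail {𝒪 : ObjClass} (hT : LocalVariationalHodgeFor 𝒪)
    {G : ℕ} (hSR : ∀ m : ℕ, G < 2 * m → AdmissibleRepresentativesLefAtDeg 𝒪 (2 * m) m) :
    OneParameterAbelianSchemeVHCUncountable := by
  intro n 𝒳 S f hf h𝒳 hirr haff hsm hdim habel he p W hW s₀ hs₀
  haveI := hirr
  haveI := haff
  haveI := hsm
  exact not_countable_algebraicityLocus_of_diagonal_tail hT hSR f hf h𝒳 hdim habel he p W hW hs₀

/-- **Node (U) from the door and the diagonal cells `(2m, m)`, `m ≥ M₀` — for EVERY `M₀`, FACT-FREE.** Part X-a had `M₀ = 2`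
(and `M₀ = 3` modulo `HCUpToDim 5`); part X-b `M₀ = 4` modulo `HC_CM`. [cite: CharlesSchnell2014Notes, Prop. 11.3.11 (proof)]
[cite: BrosnanFangNiePearlstein2009, §6 Lemma 48] [cite: Fulton1998, §10.1 Cor. 10.1] -/
theorem oneParameterAbelianSchemeVHCUncountable_of_lefAtDeg_diagonal_ge {𝒪 : ObjClass} (hT : LocalVariationalHodgeFor 𝒪)
    (M₀ : ℕ) (hSR : ∀ m : ℕ, M₀ ≤ m → AdmissibleRepresentativesLefAtDeg 𝒪 (2 * m) m) :
    OneParameterAbelianSchemeVHCUncountable :=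
  oneParameterAbelianSchemeVHCUncountable_of_lefAtDeg_diagonal_tail hT (G := 2 * M₀) fun m hm => hSR m (by omega)

/-- **Row b02 from the door, ANY TAIL `m ≥ M₀` of the diagonal and the curve residual — no class target, no `HC_CM`.**
[cite: CharlesSchnell2014Notes, Prop. 11.3.11 (proof)] [cite: GortzWedhorn2023, Thm. 27.291] -/
theorem abelianSchemeVHC_of_lefAtDeg_diagonal_ge {𝒪 : ObjClass} (hT : LocalVariationalHodgeFor 𝒪) (M₀ : ℕ)
    (hSR : ∀ m : ℕ, M₀ ≤ m → AdmissibleRepresentativesLefAtDeg 𝒪 (2 * m) m)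
    (hqp : OneParameterAbelianSchemeQuasiProjective) : AbelianSchemeVHC :=
  abelianSchemeVHC_of_uncountable_of_oneParameterAbelianSchemeQuasiProjective hqp
    (oneParameterAbelianSchemeVHCUncountable_of_lefAtDeg_diagonal_ge hT M₀ hSR)

/-- **`HC_AV` from the door, ANY TAIL `(2m, m)`, `m ≥ M₀`, of the crux's diagonal, the curve residual and André 1996 #21/#22 — no
class target, no `HC_CM`, every `M₀`.** Supersedes part X-a (`M₀ = 2`; `M₀ = 3` mod Markman ≤ 5), part X-b (`M₀ = 4` mod `HC_CM`)
and part X-d (`M₀ = 6` mod `HC_CM`; `M₀ = 8` mod `HC_CM` + Markman): on this road `HC_CM` and `HCUpToDim 5` are IDLE for `HC_AV`.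
[cite: Andre1996Motifs, §6.3 Lemmes 6.3.1–6.3.3 and Remarque 2 (p. 33)] [cite: BrosnanFangNiePearlstein2009, §6 Lemma 48]
[cite: Fulton1998, §10.1 Cor. 10.1] -/
theorem hc_av_of_lefAtDeg_diagonal_ge {𝒪 : ObjClass} (hT : LocalVariationalHodgeFor 𝒪) (M₀ : ℕ)
    (hSR : ∀ m : ℕ, M₀ ≤ m → AdmissibleRepresentativesLefAtDeg 𝒪 (2 * m) m)
    (hqp : OneParameterAbelianSchemeQuasiProjective) (h₂₁ : andre1996_cmAnchoredPencil)
    (h₂₂ : andre1996_cmHodgeClasses_algebraicallyAnchoredPencils) :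
    Theses.PadicSemiregularLift.HodgeAbelianVarieties :=
  (Ring2.Deform.HC_AV_iff_abelianSchemeVHC_of_andre1996 h₂₁ h₂₂).mpr (abelianSchemeVHC_of_lefAtDeg_diagonal_ge hT M₀ hSR hqp)

/-! ## §4 Over the road's TWISTED door: the `closes`-shape with the crux replaced by ANY TAIL of its diagonal -/

/-- **`HC_AV` in the `closes`-shape of road b02 with the crux `SemiregularSheafRepresentativesTwAt` REPLACED by ANY TAIL of its
diagonal slice, `∀ C m, M₀ ≤ m → LefAtExceptionalRegimeAt (twisted door) (2m) m`** — K-C, the twisted door, Raynaud, André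
#21/#22 as in `Theses.VHCAbelianSchemesRoad.closes`; no class target, no `HC_CM`, EVERY `M₀`. In the option-(α) crux «regime 2 at
every diagonal cell `m ≥ 2`» no single cell — neither `(4, 2)` nor the BC5 rung `(6, 3)` — is load-bearing for `HC_AV`.
[cite: Andre1996Motifs, §6.3 Lemmes 6.3.1–6.3.3] [cite: BrosnanFangNiePearlstein2009, §6 Lemma 48]
[cite: Pridham2024Semiregularity, Cor. 2.25 and Rem. 2.27] [cite: GortzWedhorn2023, Thm. 27.291] [cite: Fulton1998, §10.1 Cor. 10.1] -/
theorem hc_av_of_exceptionalRegimeAt_twisted_diagonal_ge (hC : ChernCharacterOnBetti)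
    {Adm : PerfectAdmissibility} (hAdm : ∀ n X₀ I E, bfSingleAdmissible n X₀ I E → Adm n X₀ I E) (M₀ : ℕ)
    (hDiag : ∀ (C : ChernCharacterBetti) (m : ℕ), M₀ ≤ m → LefAtExceptionalRegimeAt (twistedReflexiveClass C Adm) (2 * m) m)
    (hDoor : ∀ C : ChernCharacterBetti, TwistedPerfectDoorVHC C Adm)
    (hR : raynaud1970_abelianScheme_section_projective) (h₂₁ : andre1996_cmAnchoredPencil)
    (h₂₂ : andre1996_cmHodgeClasses_algebraicallyAnchoredPencils) :
    Theses.PadicSemiregularLift.HodgeAbelianVarieties := by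
  obtain ⟨C⟩ := hC
  exact hc_av_of_lefAtDeg_diagonal_ge (𝒪 := twistedReflexiveClass C Adm) (hDoor C) M₀
    (fun m hm => admissibleRepresentativesLefAtDeg_twisted_of_exceptionalRegimeAt C hAdm (hDiag C m hm))
    (oneParameterAbelianSchemeQuasiProjective_of_raynaud1970 hR) h₂₁ h₂₂

/-- **Option (β) of the LEAD's pre-read WITHOUT its residual**: `HC_AV` from K-C, the twisted door, Raynaud, André #21/#22 and regime 2
on the diagonal from `(6, 3)` on — no `HodgeAbelianDimLeFive` (part X-a's `hc_av_of_hcUpToDim_five_of_exceptionalRegimeAt_twisted_diagonal_three`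
with Markman ≤ 5 struck). [cite: Andre1996Motifs, §6.3 Lemmes 6.3.1–6.3.3] [cite: BrosnanFangNiePearlstein2009, §6 Lemma 48]
[cite: Fulton1998, §10.1 Cor. 10.1] -/
theorem hc_av_of_exceptionalRegimeAt_twisted_diagonal_three (hC : ChernCharacterOnBetti)
    {Adm : PerfectAdmissibility} (hAdm : ∀ n X₀ I E, bfSingleAdmissible n X₀ I E → Adm n X₀ I E)
    (hDiag : ∀ (C : ChernCharacterBetti) (m : ℕ), 3 ≤ m → LefAtExceptionalRegimeAt (twistedReflexiveClass C Adm) (2 * m) m)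
    (hDoor : ∀ C : ChernCharacterBetti, TwistedPerfectDoorVHC C Adm)
    (hR : raynaud1970_abelianScheme_section_projective) (h₂₁ : andre1996_cmAnchoredPencil)
    (h₂₂ : andre1996_cmHodgeClasses_algebraicallyAnchoredPencils) :
    Theses.PadicSemiregularLift.HodgeAbelianVarieties :=
  hc_av_of_exceptionalRegimeAt_twisted_diagonal_ge hC hAdm 3 hDiag hDoor hR h₂₁ h₂₂

/-- **The TAIL STUB of the option-(α) candidate skeleton ALONE closes `HC_AV`**: regime 2 on the diagonal from `(8, 4)` on (the
candidate's `stub_diagonalTailTw`), K-C, the twisted door, Raynaud, André #21/#22 — the cells `(4, 2)` and `(6, 3)` unused; no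
`HC_CM` (part X-b's `hc_av_of_HC_CM_of_exceptionalRegimeAt_twisted_diagonal_four` with `HC_CM` struck).
[cite: Andre1996Motifs, §6.3 Lemmes 6.3.1–6.3.3] [cite: BrosnanFangNiePearlstein2009, §6 Lemma 48] [cite: Fulton1998, §10.1 Cor. 10.1] -/
theorem hc_av_of_exceptionalRegimeAt_twisted_diagonal_four (hC : ChernCharacterOnBetti)
    {Adm : PerfectAdmissibility} (hAdm : ∀ n X₀ I E, bfSingleAdmissible n X₀ I E → Adm n X₀ I E)
    (hDiag : ∀ (C : ChernCharacterBetti) (m : ℕ), 4 ≤ m → LefAtExceptionalRegimeAt (twistedReflexiveClass C Adm) (2 * m) m)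
    (hDoor : ∀ C : ChernCharacterBetti, TwistedPerfectDoorVHC C Adm)
    (hR : raynaud1970_abelianScheme_section_projective) (h₂₁ : andre1996_cmAnchoredPencil)
    (h₂₂ : andre1996_cmHodgeClasses_algebraicallyAnchoredPencils) :
    Theses.PadicSemiregularLift.HodgeAbelianVarieties :=
  hc_av_of_exceptionalRegimeAt_twisted_diagonal_ge hC hAdm 4 hDiag hDoor hR h₂₁ h₂₂

/-- **Parts X-b/X-d's `HC_CM` slices WITHOUT `HC_CM`**: `HC_AV` from regime 2 on the diagonal from `(12, 6)` on, K-C, the twisted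
door, Raynaud and André #21/#22 — no `HC_CM`, no Markman ≤ 5 (part X-d's `hc_av_of_HC_CM_of_lefAtDeg_diagonal_six` and part X-b's
`hc_av_of_HC_CM_of_hcUpToDim_five_of_exceptionalRegimeAt_twisted_diagonal_six` with both struck).
[cite: Andre1996Motifs, §6.3 Lemmes 6.3.1–6.3.3] [cite: BrosnanFangNiePearlstein2009, §6 Lemma 48] [cite: Fulton1998, §10.1 Cor. 10.1] -/
theorem hc_av_of_exceptionalRegimeAt_twisted_diagonal_six (hC : ChernCharacterOnBetti)
    {Adm : PerfectAdmissibility} (hAdm : ∀ n X₀ I E, bfSingleAdmissible n X₀ I E → Adm n X₀ I E)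
    (hDiag : ∀ (C : ChernCharacterBetti) (m : ℕ), 6 ≤ m → LefAtExceptionalRegimeAt (twistedReflexiveClass C Adm) (2 * m) m)
    (hDoor : ∀ C : ChernCharacterBetti, TwistedPerfectDoorVHC C Adm)
    (hR : raynaud1970_abelianScheme_section_projective) (h₂₁ : andre1996_cmAnchoredPencil)
    (h₂₂ : andre1996_cmHodgeClasses_algebraicallyAnchoredPencils) :
    Theses.PadicSemiregularLift.HodgeAbelianVarieties :=
  hc_av_of_exceptionalRegimeAt_twisted_diagonal_ge hC hAdm 6 hDiag hDoor hR h₂₁ h₂₂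

/-! ## Audit: fact-free (closures are the three standard axioms; no named fact, no `HC_CM`, no class target) -/

#print axioms Summit.HodgeConjecture.HodgeConjecture.Ring2.SemiregularRepresentatives.exists_purePadding
#print axioms Summit.HodgeConjecture.HodgeConjecture.Ring2.SemiregularRepresentatives.not_countable_algebraicityLocus_of_diagonal_tail
#print axioms Summit.HodgeConjecture.HodgeConjecture.Ring2.SemiregularRepresentatives.hc_av_of_exceptionalRegimeAt_twisted_diagonal_ge

end Summit.HodgeConjecture.HodgeConjecture.Ring2.SemiregularRepresentatives

end
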